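import Mathlib
import Summits.MatrixMultiplication.MatrixMultiplication.Theorems.SnSubsetDichotomyPolynomialSlackStructure
import Summits.MatrixMultiplication.MatrixMultiplication.Theorems.SnSubsetDichotomyPolynomialSlackStructureSharp
import Summits.MatrixMultiplication.MatrixMultiplication.Theorems.SnSubsetDichotomyPolynomialSlackTwoDenseSharp
import Summits.MatrixMultiplication.MatrixMultiplication.Theorems.SnSubsetDichotomyPolynomialSlackKeptSplitABC
import Summits.MatrixMultiplication.MatrixMultiplication.Theorems.SnSubsetDichotomyPolynomialSlackOneDenseAtoms

/-!
# The 2/3 step: the structure theorem for pure violators, atoms version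

Crux `Summit.MatrixMultiplication.MatrixMultiplication.Theses.SnSubsetDichotomy.PolynomialSlack`
(item `stmt-MatrixMultiplication-8306`), level-one programme, lead c9 (the atoms endgame), line
transport-split-hull, registered stub `pure_violator_volume_le_atoms`. The atoms form of
`pure_violator_volume_le_sharp` (file `…StructureSharp`): a parity-pure TPP triple `S, T, U ⊆ S_n`
(`n ≥ 40`) with `F := n!√(n!)/N ≤ 8n`, `F² ≤ n^{134/100}`, a scale `1 ≤ M ≤ n⁴` with `4096M³ ≤ F²`,
`1400000(1+log n)² ≤ n`, the level-one smallness `hsmall₁` (no one-dense excess term any more), the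
two-dense smallness `hsmall₂` and the four explicit range conditions `hE1, hE3, hE4, hE5` of the atoms
endgame (`Λ = 1200(1+log n)²`) fibres over `S_{n-1}`:

  `|S||T||U| ≤ 3·10²⁴(1+log n)¹²·n·B + 2·10³⁵Λ⁶(1+log n)⁸(log(8000Λ·16n⁴))²·n^{149/100}·B`

for every bound `B` on the TPP volumes of `S_{n-1}` (`pure_violator_volume_le_atoms`). Proof: the
co-densities `K_A, K_B, K_C` of the three quotient sets multiply to `F² ≥ 4096M³`, so not all three are
`< 16M`; if none is, `one_le_error_of_split_ABC` contradicts `hsmall₁`; if exactly one is, rotate it into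
the `A` slot and use `volume_le_of_one_dense_atoms` (second summand); if exactly two are, rotate the third
into the `C` slot and use `volume_le_of_two_dense_sharp` (first summand).
-/

namespace Summit.MatrixMultiplication.MatrixMultiplication.Theorems.PolynomialSlack

open scoped BigOperators
open Literature.Combinatorics.Additive (TripleProductProperty)

-- `Summit.<Summit>.<Problem>` is the tree's mandated summit-side namespace (CONVENTIONS §2); for
-- this single-conjunct summit the two coincide, so each declaration silences `dupNamespace`.
set_option linter.dupNamespace false

set_option maxHeartbeats 1600000 in
/-- **Structure theorem for pure violators, atoms version** (registered sub-goal
`pure_violator_volume_le_atoms` of the 2/3 programme). For `n ≥ 40`, a parity-pure TPP triple of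
non-empty sets with `F = n!√(n!)/N ≤ 8n`, `F² ≤ n^{134/100}`, a scale `1 ≤ M ≤ n⁴` with `4096M³ ≤ F²`,
`1400000(1+log n)² ≤ n`, the level-one smallness `hsmall₁ ≤ 1/1000`, the range conditions
`hE1, hE3, hE4, hE5` and the two-dense smallness `hsmall₂`, every bound `B` on the TPP volumes of
`S_{n-1}` gives `|S||T||U| ≤ 3·10²⁴(1+log n)¹²·n·B + 2·10³⁵Λ⁶(1+log n)⁸(log(8000Λ·16n⁴))²n^{149/100}B`
(`Λ = 1200(1+log n)²`). [folklore] -/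
theorem pure_violator_volume_le_atoms {n : ℕ} (hn : 40 ≤ n) (B : ℕ)
    (hB : ∀ S' T' U' : Finset (Equiv.Perm (Fin (n - 1))), TripleProductProperty S' T' U' →
      S'.card * T'.card * U'.card ≤ B)
    {S T U : Finset (Equiv.Perm (Fin n))} (hTPP : TripleProductProperty S T U)
    (hS0 : S.Nonempty) (hT0 : T.Nonempty) (hU0 : U.Nonempty)
    (hS : ∀ s ∈ S, ∀ s' ∈ S, Equiv.Perm.sign s = Equiv.Perm.sign s')
    (hT : ∀ t ∈ T, ∀ t' ∈ T, Equiv.Perm.sign t = Equiv.Perm.sign t')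
    (hU : ∀ u ∈ U, ∀ u' ∈ U, Equiv.Perm.sign u = Equiv.Perm.sign u')
    (M : ℝ) (hM : 1 ≤ M) (hMn : M ≤ (n : ℝ) ^ 4)
    (hnG : 1400000 * (1 + Real.log n) ^ 2 ≤ (n : ℝ))
    (hM3 : 4096 * M ^ 3 ≤
      ((n.factorial : ℝ) * Real.sqrt (n.factorial : ℝ) / (S.card * T.card * U.card : ℕ)) ^ 2)
    (hF : (n.factorial : ℝ) * Real.sqrt (n.factorial : ℝ) / (S.card * T.card * U.card : ℕ) ≤ 8 * n)
    (hsmall₁ : (n.factorial : ℝ) * Real.sqrt (n.factorial : ℝ) / (S.card * T.card * U.card : ℕ) *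
        (Real.sqrt 6 / Real.sqrt ((n : ℝ) * ((n : ℝ) - 1)) +
          30 * Real.sqrt ((1 + Real.log n) * (6 * (1 + Real.log n)) / M) / Real.sqrt ((n : ℝ) - 1)) ≤
      1 / 1000)
    (hF134 : ((n.factorial : ℝ) * Real.sqrt (n.factorial : ℝ) / (S.card * T.card * U.card : ℕ)) ^ 2 ≤
      (n : ℝ) ^ (134 / 100 : ℝ))
    (hE1 : Real.log (2 * 10 ^ 10 * (1200 * (1 + Real.log n) ^ 2) ^ 2 * n * (1 + Real.log n) *
        Real.log (8000 * (1200 * (1 + Real.log n) ^ 2) * (16 * (n : ℝ) ^ 4))) ≤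
      101 / 100 * Real.log n)
    (hE3 : 8 * 10 ^ 8 * (1200 * (1 + Real.log n) ^ 2) ^ 4 * (1 + Real.log n) ^ 2 ≤ (n : ℝ))
    (hE4 : 16 * Real.log (160000 * (1200 * (1 + Real.log n) ^ 2) * (1 + Real.log n)) + 4 ≤
      5 / 1000 * Real.log n)
    (hE5 : Real.log (40000 * (1200 * (1 + Real.log n) ^ 2) ^ 2 * (1 + Real.log n)) ≤
      45 / 1000 * Real.log n)
    (hsmall₂ : (n.factorial : ℝ) * Real.sqrt (n.factorial : ℝ) / (S.card * T.card * U.card : ℕ) *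
          (Real.sqrt 6 / Real.sqrt ((n : ℝ) * ((n : ℝ) - 1)) +
            30 * Real.sqrt ((1 + Real.log n) * (6 * (1 + Real.log n)) / M) / Real.sqrt ((n : ℝ) - 1)) +
        256 * (1200 * (1 + Real.log n) ^ 2) ^ 2 * n * M ^ 4 /
          (((n : ℝ) - 1) *
            ((n.factorial : ℝ) * Real.sqrt (n.factorial : ℝ) / (S.card * T.card * U.card : ℕ)) ^ 2) ≤
        1 / (5 * 10 ^ 14 * (1 + Real.log n) ^ 8)) :
    ((S.card * T.card * U.card : ℕ) : ℝ) ≤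
      3 * 10 ^ 24 * (1 + Real.log n) ^ 12 * n * B +
        2 * 10 ^ 35 * (1200 * (1 + Real.log n) ^ 2) ^ 6 * (1 + Real.log n) ^ 8 *
          (Real.log (8000 * (1200 * (1 + Real.log n) ^ 2) * (16 * (n : ℝ) ^ 4))) ^ 2 *
            (n : ℝ) ^ (149 / 100 : ℝ) * B := by
  classical
  /- scalars -/
  have hn1 : 1 ≤ n := by omega
  have hn2 : 2 ≤ n := by omega
  have hnR : (40 : ℝ) ≤ n := by exact_mod_cast hn
  have hn0 : (0 : ℝ) < n := by linarith
  have hm0 : (0 : ℝ) < (n : ℝ) - 1 := by linarith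
  have hM0 : 0 < M := by linarith
  have hf0 : (0 : ℝ) < n.factorial := by exact_mod_cast n.factorial_pos
  have hG1 : 1 ≤ 1 + Real.log n := by
    have := Real.log_nonneg (show (1 : ℝ) ≤ n by linarith); linarith
  have hG0 : 0 < 1 + Real.log n := by linarith
  set G : ℝ := 1 + Real.log n with hG
  have hL1 : (1 : ℝ) ≤ 6 * G := by linarith
  -- the volume and the pair sizes, as reals
  have hcS0 : (0 : ℝ) < S.card := by exact_mod_cast hS0.card_pos
  have hcT0 : (0 : ℝ) < T.card := by exact_mod_cast hT0.card_pos
  have hcU0 : (0 : ℝ) < U.card := by exact_mod_cast hU0.card_pos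
  obtain ⟨N, hNdef⟩ : ∃ N : ℝ, N = (S.card : ℝ) * T.card * U.card := ⟨_, rfl⟩
  have hN0 : 0 < N := by rw [hNdef]; positivity
  have hNe : ((S.card * T.card * U.card : ℕ) : ℝ) = N := by rw [hNdef]; push_cast; ring
  have hNe' : ((T.card * U.card * S.card : ℕ) : ℝ) = N := by rw [hNdef]; push_cast; ring
  have hNe'' : ((U.card * S.card * T.card : ℕ) : ℝ) = N := by rw [hNdef]; push_cast; ring
  obtain ⟨F, hFdef⟩ : ∃ F : ℝ, F = (n.factorial : ℝ) * Real.sqrt (n.factorial : ℝ) / N := ⟨_, rfl⟩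
  have hF0 : 0 < F := by rw [hFdef]; positivity
  have hF8 : F ≤ 8 * n := by rw [hFdef, ← hNe]; exact hF
  -- the three injectivities and pair sizes `≤ n!`
  have hinjA := injOn_quot_first hTPP hU0
  have hinjB := injOn_quot_second hTPP hS0
  have hinjC := injOn_quot_first hTPP.rotate.rotate hT0
  have hαle : ((S.card * T.card : ℕ) : ℝ) ≤ n.factorial := by
    exact_mod_cast card_mul_card_le_factorial_of_injOn hinjA
  have hβle : ((T.card * U.card : ℕ) : ℝ) ≤ n.factorial := by
    exact_mod_cast card_mul_card_le_factorial_of_injOn hinjB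
  have hγle : ((U.card * S.card : ℕ) : ℝ) ≤ n.factorial := by
    exact_mod_cast card_mul_card_le_factorial_of_injOn hinjC
  have hα0 : (0 : ℝ) < (S.card * T.card : ℕ) := by push_cast; positivity
  have hβ0 : (0 : ℝ) < (T.card * U.card : ℕ) := by push_cast; positivity
  have hγ0 : (0 : ℝ) < (U.card * S.card : ℕ) := by push_cast; positivity
  -- the co-densities
  obtain ⟨KA, hKA⟩ : ∃ K : ℝ, K = (n.factorial : ℝ) / (S.card * T.card : ℕ) := ⟨_, rfl⟩
  obtain ⟨KB, hKB⟩ : ∃ K : ℝ, K = (n.factorial : ℝ) / (T.card * U.card : ℕ) := ⟨_, rfl⟩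
  obtain ⟨KC, hKC⟩ : ∃ K : ℝ, K = (n.factorial : ℝ) / (U.card * S.card : ℕ) := ⟨_, rfl⟩
  have hKA0 : 0 < KA := by rw [hKA]; positivity
  have hKB0 : 0 < KB := by rw [hKB]; positivity
  have hKC0 : 0 < KC := by rw [hKC]; positivity
  have hprod : ((S.card * T.card : ℕ) : ℝ) * (T.card * U.card : ℕ) * (U.card * S.card : ℕ) = N ^ 2 := by
    rw [hNdef]; push_cast; ring
  have hKKK : KA * KB * KC = F ^ 2 := by
    rw [hKA, hKB, hKC, hFdef, div_pow, mul_pow, Real.sq_sqrt hf0.le, ← hprod]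
    field_simp
  -- `K_X ≤ F² ≤ 64n²`, hence the pair logarithms are `≤ 6G`
  have hF2up : F ^ 2 ≤ 64 * (n : ℝ) ^ 2 := by
    have h0 : 0 ≤ 8 * (n : ℝ) := by positivity
    calc F ^ 2 = F * F := sq F
      _ ≤ (8 * (n : ℝ)) * (8 * (n : ℝ)) := mul_le_mul hF8 hF8 hF0.le h0
      _ = 64 * (n : ℝ) ^ 2 := by ring
  have hKAF : KA ≤ F ^ 2 := by
    rw [← hKKK]
    have h1 : 1 ≤ KB := by rw [hKB, le_div_iff₀ hβ0]; linarith
    have h2 : 1 ≤ KC := by rw [hKC, le_div_iff₀ hγ0]; linarith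
    calc KA = KA * 1 * 1 := by ring
      _ ≤ KA * KB * KC := by gcongr
  have hKBF : KB ≤ F ^ 2 := by
    rw [← hKKK]
    have h1 : 1 ≤ KA := by rw [hKA, le_div_iff₀ hα0]; linarith
    have h2 : 1 ≤ KC := by rw [hKC, le_div_iff₀ hγ0]; linarith
    calc KB = 1 * KB * 1 := by ring
      _ ≤ KA * KB * KC := by gcongr
  have hKCF : KC ≤ F ^ 2 := by
    rw [← hKKK]
    have h1 : 1 ≤ KA := by rw [hKA, le_div_iff₀ hα0]; linarith
    have h2 : 1 ≤ KB := by rw [hKB, le_div_iff₀ hβ0]; linarith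
    calc KC = 1 * 1 * KC := by ring
      _ ≤ KA * KB * KC := by gcongr
  have hLA := log_pair_le_six hn2 hα0 (hKA ▸ hKAF) hF2up
  have hLB := log_pair_le_six hn2 hβ0 (hKB ▸ hKBF) hF2up
  have hLC := log_pair_le_six hn2 hγ0 (hKC ▸ hKCF) hF2up
  /- the level-one error: `δ_expr < 1` -/
  have herr := levelOneError_le hn2 N G (6 * G) M hN0
  rw [← hFdef] at herr
  have hsmall₁' := hsmall₁
  rw [hNe, ← hFdef] at hsmall₁'
  have hδlt : (n.factorial : ℝ) / (2 * N) +
      (n.factorial : ℝ) * Real.sqrt (n.factorial : ℝ) / (2 * N * Real.sqrt (((n * (n - 1) : ℕ) : ℝ) / 6)) +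
      3 * Real.sqrt (100 * G * (6 * G) / M) * F / Real.sqrt ((n : ℝ) - 1) < 1 := by
    linarith
  /- not all three quotients are dense -/
  have hM3' : 4096 * M ^ 3 ≤ F ^ 2 := by rw [hFdef, ← hNe]; exact hM3
  have hnot3 : ¬ (KA < 16 * M ∧ KB < 16 * M ∧ KC < 16 * M) := by
    rintro ⟨hA, hB', hC⟩
    have h1 : KA * KB * KC < 16 * M * (16 * M) * (16 * M) := by
      have h2 : KA * KB < 16 * M * (16 * M) := mul_lt_mul'' hA hB' hKA0.le hKB0.le
      exact mul_lt_mul'' h2 hC (by positivity) hKC0.le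
    rw [hKKK] at h1
    have e : 16 * M * (16 * M) * (16 * M) = 4096 * M ^ 3 := by ring
    rw [e] at h1
    linarith
  /- the case analysis -/
  have hB0 : (0 : ℝ) ≤ B := Nat.cast_nonneg _
  have hbig : 0 ≤ G ^ 12 * n * B := by positivity
  have hbig₁ : 0 ≤ 3 * 10 ^ 24 * G ^ 12 * n * B := by positivity
  have hbig₂ : 0 ≤ 2 * 10 ^ 35 * (1200 * G ^ 2) ^ 6 * G ^ 8 *
      (Real.log (8000 * (1200 * G ^ 2) * (16 * (n : ℝ) ^ 4))) ^ 2 * (n : ℝ) ^ (149 / 100 : ℝ) * B := by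
    positivity
  have hc2 : (64800 * 9600 ^ 2 * 700000 ^ 2 : ℝ) ≤ 3 * 10 ^ 24 := by norm_num
  have finish : ∀ c : ℝ, c ≤ 3 * 10 ^ 24 → N ≤ c * G ^ 12 * n * B →
      N ≤ 3 * 10 ^ 24 * G ^ 12 * n * B + 2 * 10 ^ 35 * (1200 * G ^ 2) ^ 6 * G ^ 8 *
        (Real.log (8000 * (1200 * G ^ 2) * (16 * (n : ℝ) ^ 4))) ^ 2 * (n : ℝ) ^ (149 / 100 : ℝ) * B := by
    intro c hc h
    have h1 := mul_le_mul_of_nonneg_right hc hbig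
    have h2 : c * G ^ 12 * n * B = c * (G ^ 12 * n * B) := by ring
    have h3 : (3 * 10 ^ 24 : ℝ) * G ^ 12 * n * B = 3 * 10 ^ 24 * (G ^ 12 * n * B) := by ring
    rw [h3]; rw [h2] at h
    linarith
  have finish' : N ≤ 2 * 10 ^ 35 * (1200 * G ^ 2) ^ 6 * G ^ 8 *
        (Real.log (8000 * (1200 * G ^ 2) * (16 * (n : ℝ) ^ 4))) ^ 2 * (n : ℝ) ^ (149 / 100 : ℝ) * B →
      N ≤ 3 * 10 ^ 24 * G ^ 12 * n * B + 2 * 10 ^ 35 * (1200 * G ^ 2) ^ 6 * G ^ 8 *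
        (Real.log (8000 * (1200 * G ^ 2) * (16 * (n : ℝ) ^ 4))) ^ 2 * (n : ℝ) ^ (149 / 100 : ℝ) * B := by
    intro h
    linarith
  -- hypotheses shared by all rotations, in the raw vocabulary
  have hF' : (n.factorial : ℝ) * Real.sqrt (n.factorial : ℝ) / (S.card * T.card * U.card : ℕ) ≤ 8 * n := hF
  rcases le_or_gt (16 * M) KA with hA | hA <;> rcases le_or_gt (16 * M) KB with hB' | hB' <;>
    rcases le_or_gt (16 * M) KC with hC | hC
  · -- no dense quotient: contradiction
    exfalso
    have h := one_le_error_of_split_ABC hn hTPP hS0 hT0 hU0 hS hT hU M (6 * G) hM hL1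
      (by rw [← hKA]; exact hA) (by rw [← hKB]; exact hB') (by rw [← hKC]; exact hC) hLA hLB hLC
    rw [hNe, ← hFdef] at h
    linarith
  · -- only `C` dense: rotate twice, `(U, S, T)`
    have h := volume_le_of_one_dense_atoms hn B hB hTPP.rotate.rotate hU0 hS0 hT0 hU hS hT M hM hMn
      (by rw [← hKC]; exact hC) (by rw [← hKA]; exact hA) (by rw [← hKB]; exact hB')
      (by rw [hNe'', ← hNe]; exact hF') (by rw [hNe'', ← hNe]; exact hsmall₁)
      (by rw [hNe'', ← hNe]; exact hF134) hE1 hE3 hE4 hE5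
    rw [hNe''] at h; rw [hNe]; exact finish' h
  · -- only `B` dense: rotate once, `(T, U, S)`
    have h := volume_le_of_one_dense_atoms hn B hB hTPP.rotate hT0 hU0 hS0 hT hU hS M hM hMn
      (by rw [← hKB]; exact hB') (by rw [← hKC]; exact hC) (by rw [← hKA]; exact hA)
      (by rw [hNe', ← hNe]; exact hF') (by rw [hNe', ← hNe]; exact hsmall₁)
      (by rw [hNe', ← hNe]; exact hF134) hE1 hE3 hE4 hE5
    rw [hNe'] at h; rw [hNe]; exact finish' h
  · -- `B, C` dense, `A` not: rotate once, `(T, U, S)` has its third quotient `A`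
    have h := volume_le_of_two_dense_sharp hn B hB hTPP.rotate hT0 hU0 hS0 hT hU hS M hM hMn hnG
      (by rw [← hKB]; exact hB') (by rw [← hKC]; exact hC) (by rw [← hKA]; exact hA)
      (by rw [hNe', ← hNe]; exact hF') (by rw [hNe', ← hNe]; exact hsmall₂)
    rw [hNe'] at h; rw [hNe]; exact finish _ hc2 h
  · -- only `A` dense
    have h := volume_le_of_one_dense_atoms hn B hB hTPP hS0 hT0 hU0 hS hT hU M hM hMn
      (by rw [← hKA]; exact hA) (by rw [← hKB]; exact hB') (by rw [← hKC]; exact hC) hF' hsmall₁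
      hF134 hE1 hE3 hE4 hE5
    rw [hNe] at h ⊢; exact finish' h
  · -- `A, C` dense, `B` not: rotate twice, `(U, S, T)` has its third quotient `B`
    have h := volume_le_of_two_dense_sharp hn B hB hTPP.rotate.rotate hU0 hS0 hT0 hU hS hT M hM hMn hnG
      (by rw [← hKC]; exact hC) (by rw [← hKA]; exact hA) (by rw [← hKB]; exact hB')
      (by rw [hNe'', ← hNe]; exact hF') (by rw [hNe'', ← hNe]; exact hsmall₂)
    rw [hNe''] at h; rw [hNe]; exact finish _ hc2 h
  · -- `A, B` dense, `C` not
    have h := volume_le_of_two_dense_sharp hn B hB hTPP hS0 hT0 hU0 hS hT hU M hM hMn hnG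
      (by rw [← hKA]; exact hA) (by rw [← hKB]; exact hB') (by rw [← hKC]; exact hC) hF' hsmall₂
    rw [hNe] at h ⊢; exact finish _ hc2 h
  · exact absurd ⟨hA, hB', hC⟩ hnot3

end Summit.MatrixMultiplication.MatrixMultiplication.Theorems.PolynomialSlack
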